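import Literature.AlgebraicGeometry.Motives.MixedHodgeStructureSemisimple
import Literature.AlgebraicGeometry.Motives.MixedHodgeStructureProd
import HarnessLib

/-!
# Semisimple mixed Hodge structures: direct sums, sums, and simple objects

In the abelian category of mixed Hodge structures (Cattani–El Zein–Griffiths–Lê, *Hodge Theory*, Thm. 3.2.18)
"simple := irreducible := no nontrivial subobject; semisimple := direct sum of simples" (op. cit., p. 270, and
p. 278: "semisimple (= direct sum of simples; simple = no nontrivial subobject)"). The file
`MixedHodgeStructureSemisimple` defines `IsSemisimple H` as "every sub-MHS is a direct summand"; here we prove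
the closure properties of that notion and its agreement with "direct sum of simples" (everything proved, no
named facts; namespace `MixedHodgeStructure`):

* §1 **`IsSemisimple.of_isCompl`** — if `H = S ⊕ T` with `S`, `T` semisimple sub-MHS then `H` is semisimple;
  **`IsSemisimple.prod`** (`H₁ ⊕ H₂`).
* §2 **`IsSemisimple.sup`** — the sum `S + T ⊆ H` of two semisimple sub-MHS is semisimple (a quotient of
  `S ⊕ T`); finite sums `IsSemisimple.biSup_finset`.
* §3 **simple MHS** `IsSimple` (non-zero, no sub-MHS other than `0` and itself): `IsSimple.isSemisimple`,
  invariance under isomorphism, one-dimensional MHS (`isSimple_of_finrank_eq_one`, the Tate structures).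
* §4 **`isSemisimple_iff_exists_finset_isSimple`**: `H` is semisimple iff `V` is the sum of finitely many simple
  sub-MHS (⇐ by §2–§3; ⇒ by splitting off a simple sub-MHS of minimal dimension and induction on `dim V`).

## References

* [CattaniElZeinGriffithsLe2014] E. Cattani et al. (eds.), Hodge Theory (2014), Thm. 3.2.18, Lemma 3.2.20;
  p. 270 and p. 278 (simple / semisimple objects); Ch. 12 footnote 2 (p. 527).
* [Jannsen1990MixedMotives] U. Jannsen, Mixed Motives and Algebraic K-Theory, LNM 1400 (1990), 7.8 b).
-/

noncomputable section

open scoped TensorProduct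

namespace Literature.AlgebraicGeometry.Motives

namespace MixedHodgeStructure

universe u v

variable {V : Type u} [AddCommGroup V] [Module ℚ V]
variable {V' : Type v} [AddCommGroup V'] [Module ℚ V']
variable {H : MixedHodgeStructure V} {H' : MixedHodgeStructure V'}

/-! ### §1 Internal and external direct sums -/

namespace SubMixedHodgeStructure

/-- `x - π_T(x) ∈ S` for the projection `π_T : H → T` along `S` (`S ⊕ T = H`). [cite: CattaniElZeinGriffithsLe2014, Thm. 3.2.18] -/
theorem sub_coe_projOfIsCompl_mem (S T : SubMixedHodgeStructure H) (h : IsCompl S.toSubmodule T.toSubmodule) (x : V) :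
    x - ((projOfIsCompl S T h).toLinearMap x : V) ∈ S.toSubmodule := by
  have hx : x ∈ S.toSubmodule ⊔ T.toSubmodule := by rw [h.sup_eq_top]; exact Submodule.mem_top
  obtain ⟨s, hs, t, ht, rfl⟩ := Submodule.mem_sup.1 hx
  rw [map_add, projOfIsCompl_apply_of_mem_left S T h hs, zero_add, projOfIsCompl_apply_of_mem_right S T h ⟨t, ht⟩,
    add_sub_cancel_right]
  exact hs

/-- The image of a sub-MHS `R ⊆ S` of `S ⊆ H` in `H` is isomorphic to `R`: the corestriction of `S ↪ H ∘ R ↪ S`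
is a bijective morphism onto `S.ofSub R`. [cite: CattaniElZeinGriffithsLe2014, Lemma 3.2.20] -/
theorem range_subtype_comp_subtype (S : SubMixedHodgeStructure H) (R : SubMixedHodgeStructure S.toMixedHodgeStructure) :
    (S.subtype.comp R.subtype).range = S.ofSub R :=
  ext (by
    rw [Hom.range_toSubmodule, ofSub_toSubmodule, Hom.comp_toLinearMap, LinearMap.range_comp]
    change Submodule.map S.toSubmodule.subtype (LinearMap.range R.toSubmodule.subtype) = _
    rw [Submodule.range_subtype])

/-- `R ≅ S.ofSub R`. [cite: CattaniElZeinGriffithsLe2014, Lemma 3.2.20] -/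
theorem exists_hom_ofSub_bijective (S : SubMixedHodgeStructure H) (R : SubMixedHodgeStructure S.toMixedHodgeStructure) :
    ∃ f : Hom R.toMixedHodgeStructure (S.ofSub R).toMixedHodgeStructure, Function.Bijective f.toLinearMap := by
  rw [← range_subtype_comp_subtype]
  refine ⟨(S.subtype.comp R.subtype).rangeRestrict, fun x y hxy => ?_, Hom.rangeRestrict_surjective _⟩
  have h' := congrArg (fun z : ↥(S.subtype.comp R.subtype).range.toSubmodule => (z : V)) hxy
  simp only [Hom.coe_rangeRestrict_apply, Hom.comp_toLinearMap, LinearMap.comp_apply] at h'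
  exact Subtype.ext (Subtype.ext h')

end SubMixedHodgeStructure

/-- An injective morphism is an isomorphism onto its image. [cite: CattaniElZeinGriffithsLe2014, Thm. 3.2.18] -/
theorem Hom.rangeRestrict_bijective_of_injective (f : Hom H H') (hf : Function.Injective f.toLinearMap) :
    Function.Bijective f.rangeRestrict.toLinearMap :=
  ⟨fun x y hxy => hf (by
      have h' := congrArg (fun z : ↥f.range.toSubmodule => (z : V')) hxy
      simpa only [Hom.coe_rangeRestrict_apply] using h'),
    f.rangeRestrict_surjective⟩

/-- The image of an injective morphism out of a semisimple MHS is semisimple. [cite: CattaniElZeinGriffithsLe2014, Thm. 3.2.18] -/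
theorem IsSemisimple.range_of_injective (h : H.IsSemisimple) (f : Hom H H') (hf : Function.Injective f.toLinearMap) :
    f.range.toMixedHodgeStructure.IsSemisimple :=
  h.of_bijective f.rangeRestrict (f.rangeRestrict_bijective_of_injective hf)

/-- `S.ofSub R` is semisimple when `R` is. [cite: CattaniElZeinGriffithsLe2014, Thm. 3.2.18] -/
theorem IsSemisimple.ofSub {S : SubMixedHodgeStructure H} {R : SubMixedHodgeStructure S.toMixedHodgeStructure}
    (h : R.toMixedHodgeStructure.IsSemisimple) : (S.ofSub R).toMixedHodgeStructure.IsSemisimple := by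
  obtain ⟨f, hf⟩ := S.exists_hom_ofSub_bijective R
  exact h.of_bijective f hf

/-- **An internal direct sum `H = S ⊕ T` of two semisimple sub-MHS is semisimple**: for a sub-MHS `R`, take
complements `S'` of `R ∩ S` in `S` and `T'` of `π_T(R)` in `T`; then `R ⊕ (S' + T') = H`.
[cite: CattaniElZeinGriffithsLe2014, Thm. 3.2.18 and p. 270] -/
theorem IsSemisimple.of_isCompl (S T : SubMixedHodgeStructure H) (hST : IsCompl S.toSubmodule T.toSubmodule)
    (hS : S.toMixedHodgeStructure.IsSemisimple) (hT : T.toMixedHodgeStructure.IsSemisimple) : H.IsSemisimple := by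
  intro R
  let π := SubMixedHodgeStructure.projOfIsCompl S T hST
  obtain ⟨S', hS'⟩ := hS (R.comap S.subtype)
  obtain ⟨T', hT'⟩ := hT (R.map π)
  refine ⟨(S.ofSub S').sup (T.ofSub T'), ?_⟩
  rw [SubMixedHodgeStructure.sup_toSubmodule, SubMixedHodgeStructure.ofSub_toSubmodule,
    SubMixedHodgeStructure.ofSub_toSubmodule]
  refine IsCompl.of_eq (eq_bot_iff.2 ?_) (eq_top_iff.2 ?_)
  · rintro x ⟨hxR, hx⟩
    obtain ⟨_, ⟨s₀, hs₀, rfl⟩, _, ⟨t₀, ht₀, rfl⟩, rfl⟩ := Submodule.mem_sup.1 hx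
    -- apply `π`: the `T'`-component lies in `π(R) ∩ T' = 0`
    have hπ : π.toLinearMap ((s₀ : V) + (t₀ : V)) = t₀ := by
      rw [map_add, SubMixedHodgeStructure.projOfIsCompl_apply_of_mem_left S T hST s₀.2, zero_add,
        SubMixedHodgeStructure.projOfIsCompl_apply_of_mem_right S T hST t₀]
    have ht₀' : t₀ ∈ (R.map π).toSubmodule ⊓ T'.toSubmodule :=
      Submodule.mem_inf.2 ⟨by rw [SubMixedHodgeStructure.map_toSubmodule]; exact ⟨_, hxR, hπ⟩, ht₀⟩
    rw [hT'.inf_eq_bot, Submodule.mem_bot] at ht₀'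
    subst ht₀'
    -- then the `S'`-component lies in `R ∩ S ∩ S' = 0`
    have hs₀' : s₀ ∈ (R.comap S.subtype).toSubmodule ⊓ S'.toSubmodule := by
      refine Submodule.mem_inf.2 ⟨?_, hs₀⟩
      rw [SubMixedHodgeStructure.comap_toSubmodule, Submodule.mem_comap]
      change (s₀ : V) ∈ R.toSubmodule
      simpa using hxR
    rw [hS'.inf_eq_bot, Submodule.mem_bot] at hs₀'
    rw [Submodule.mem_bot, hs₀']
    simp
  · -- `S ⊆ R + S'` and `T ⊆ R + S + T'`, so `H = S + T ⊆ R + (S' + T')`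
    have hS_le : S.toSubmodule ≤ R.toSubmodule ⊔ S'.toSubmodule.map S.toSubmodule.subtype := by
      intro y hy
      have hy' : y ∈ ((R.comap S.subtype).toSubmodule ⊔ S'.toSubmodule).map S.toSubmodule.subtype := by
        rw [hS'.sup_eq_top, Submodule.map_top, Submodule.range_subtype]; exact hy
      rw [Submodule.map_sup, SubMixedHodgeStructure.comap_toSubmodule] at hy'
      have hle : (R.toSubmodule.comap S.subtype.toLinearMap).map S.toSubmodule.subtype ≤ R.toSubmodule :=
        Submodule.map_comap_le _ _
      exact (sup_le_sup_right hle _ : _ ≤ _) hy'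
    have hT_le : T.toSubmodule ≤ (R.toSubmodule ⊔ S.toSubmodule) ⊔ T'.toSubmodule.map T.toSubmodule.subtype := by
      intro y hy
      have hy' : y ∈ ((R.map π).toSubmodule ⊔ T'.toSubmodule).map T.toSubmodule.subtype := by
        rw [hT'.sup_eq_top, Submodule.map_top, Submodule.range_subtype]; exact hy
      rw [Submodule.map_sup] at hy'
      have hle : (R.map π).toSubmodule.map T.toSubmodule.subtype ≤ R.toSubmodule ⊔ S.toSubmodule := by
        rw [SubMixedHodgeStructure.map_toSubmodule]
        rintro _ ⟨_, ⟨r, hr, rfl⟩, rfl⟩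
        have hsub := SubMixedHodgeStructure.sub_coe_projOfIsCompl_mem S T hST r
        rw [Submodule.subtype_apply,
          show ((π.toLinearMap r : ↥T.toSubmodule) : V) = r - (r - (π.toLinearMap r : V)) by abel]
        exact Submodule.sub_mem _ (Submodule.mem_sup_left hr) (Submodule.mem_sup_right hsub)
      exact (sup_le_sup_right hle _ : _ ≤ _) hy'
    intro x _
    have hx : x ∈ S.toSubmodule ⊔ T.toSubmodule := by rw [hST.sup_eq_top]; exact Submodule.mem_top
    refine (sup_le (hS_le.trans ?_) (hT_le.trans ?_)) hx
    · exact sup_le le_sup_left (le_sup_of_le_right le_sup_left)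
    · exact sup_le (sup_le le_sup_left (hS_le.trans (sup_le le_sup_left (le_sup_of_le_right le_sup_left))))
        (le_sup_of_le_right le_sup_right)

/-- **The direct sum `H₁ ⊕ H₂` of semisimple mixed Hodge structures is semisimple.**
[cite: CattaniElZeinGriffithsLe2014, Thm. 3.2.18 and p. 270] -/
theorem IsSemisimple.prod {H₁ : MixedHodgeStructure V} {H₂ : MixedHodgeStructure V'} (h₁ : H₁.IsSemisimple)
    (h₂ : H₂.IsSemisimple) : (H₁.prod H₂).IsSemisimple :=
  IsSemisimple.of_isCompl (Hom.inl H₁ H₂).range (Hom.inr H₁ H₂).range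
    (by rw [Hom.range_toSubmodule, Hom.range_toSubmodule]; exact LinearMap.isCompl_range_inl_inr)
    (h₁.range_of_injective _ LinearMap.inl_injective)
    (h₂.range_of_injective _ LinearMap.inr_injective)

/-! ### §2 Sums of semisimple sub-MHS -/

/-- `S + T` is the image of `S ⊕ T → H`. [cite: CattaniElZeinGriffithsLe2014, Thm. 3.2.18] -/
theorem SubMixedHodgeStructure.range_coprodDesc_subtype (S T : SubMixedHodgeStructure H) :
    (Hom.coprodDesc S.subtype T.subtype).range = S.sup T :=
  SubMixedHodgeStructure.ext (by
    rw [Hom.range_toSubmodule, SubMixedHodgeStructure.sup_toSubmodule]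
    exact (LinearMap.range_coprod _ _).trans (by
      change LinearMap.range S.toSubmodule.subtype ⊔ LinearMap.range T.toSubmodule.subtype = _
      rw [Submodule.range_subtype, Submodule.range_subtype]))

/-- **The sum `S + T ⊆ H` of two semisimple sub-MHS is semisimple** (a quotient of `S ⊕ T`).
[cite: CattaniElZeinGriffithsLe2014, Thm. 3.2.18 and p. 270] -/
theorem IsSemisimple.sup [FiniteDimensional ℚ V] {S T : SubMixedHodgeStructure H} (hS : S.toMixedHodgeStructure.IsSemisimple)
    (hT : T.toMixedHodgeStructure.IsSemisimple) : (S.sup T).toMixedHodgeStructure.IsSemisimple := by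
  rw [← SubMixedHodgeStructure.range_coprodDesc_subtype]
  exact IsSemisimple.range (hS.prod hT) (Hom.coprodDesc S.subtype T.subtype)

/-- **Finite sums of semisimple sub-MHS are semisimple**: there is a (unique) sub-MHS on `Σ_{i ∈ s} Sᵢ` and it is
semisimple. [cite: CattaniElZeinGriffithsLe2014, Thm. 3.2.18 and p. 270] -/
theorem IsSemisimple.biSup_finset [FiniteDimensional ℚ V] {ι : Type*} (S : ι → SubMixedHodgeStructure H)
    (s : Finset ι) (hS : ∀ i ∈ s, (S i).toMixedHodgeStructure.IsSemisimple) :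
    ∃ K : SubMixedHodgeStructure H, K.toSubmodule = ⨆ i ∈ s, (S i).toSubmodule ∧ K.toMixedHodgeStructure.IsSemisimple := by
  classical
  induction s using Finset.induction_on with
  | empty =>
    refine ⟨SubMixedHodgeStructure.bot H, by simp [SubMixedHodgeStructure.bot_toSubmodule], ?_⟩
    haveI : Subsingleton ↥(SubMixedHodgeStructure.bot H).toSubmodule := by
      change Subsingleton ↥(⊥ : Submodule ℚ V); infer_instance
    exact isSemisimple_of_subsingleton _
  | insert a s ha ih =>
    obtain ⟨K, hK, hKs⟩ := ih fun i hi => hS i (Finset.mem_insert_of_mem hi)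
    refine ⟨(S a).sup K, ?_, (hS a (Finset.mem_insert_self a s)).sup hKs⟩
    rw [SubMixedHodgeStructure.sup_toSubmodule, hK, Finset.iSup_insert]

/-- If `V` is a finite sum of semisimple sub-MHS then `H` is semisimple. [cite: CattaniElZeinGriffithsLe2014, Thm. 3.2.18 and p. 270] -/
theorem isSemisimple_of_biSup_finset_eq_top [FiniteDimensional ℚ V] {ι : Type*} (S : ι → SubMixedHodgeStructure H)
    (s : Finset ι) (hS : ∀ i ∈ s, (S i).toMixedHodgeStructure.IsSemisimple) (htop : ⨆ i ∈ s, (S i).toSubmodule = ⊤) :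
    H.IsSemisimple := by
  obtain ⟨K, hK, hKs⟩ := IsSemisimple.biSup_finset S s hS
  rw [htop] at hK
  exact hKs.of_bijective K.subtype ⟨Subtype.val_injective, fun x => ⟨⟨x, hK ▸ Submodule.mem_top⟩, rfl⟩⟩

/-! ### §3 Simple mixed Hodge structures -/

/-- **`H` is a simple mixed Hodge structure**: `V ≠ 0` and the only sub-MHS of `H` are `0` and `H`
("simple = no nontrivial subobject"). [cite: CattaniElZeinGriffithsLe2014, p. 270 and p. 278] -/
def IsSimple (H : MixedHodgeStructure V) : Prop :=
  Nontrivial V ∧ ∀ S : SubMixedHodgeStructure H, S.toSubmodule = ⊥ ∨ S.toSubmodule = ⊤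

/-- **A simple MHS is semisimple.** [cite: CattaniElZeinGriffithsLe2014, p. 270] -/
theorem IsSimple.isSemisimple (h : H.IsSimple) : H.IsSemisimple := fun S =>
  (h.2 S).elim (fun hS => ⟨SubMixedHodgeStructure.top H, by rw [hS, SubMixedHodgeStructure.top_toSubmodule]; exact isCompl_bot_top⟩)
    (fun hS => ⟨SubMixedHodgeStructure.bot H, by rw [hS, SubMixedHodgeStructure.bot_toSubmodule]; exact isCompl_top_bot⟩)

/-- A simple MHS lives on a non-zero space. [cite: CattaniElZeinGriffithsLe2014, p. 270] -/
theorem IsSimple.nontrivial (h : H.IsSimple) : Nontrivial V := h.1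

/-- In a simple MHS every sub-MHS is `0` or everything. [cite: CattaniElZeinGriffithsLe2014, p. 270] -/
theorem IsSimple.eq_bot_or_eq_top (h : H.IsSimple) (S : SubMixedHodgeStructure H) :
    S.toSubmodule = ⊥ ∨ S.toSubmodule = ⊤ := h.2 S

/-- **Simplicity is invariant under isomorphisms.** [cite: CattaniElZeinGriffithsLe2014, Thm. 3.2.18] -/
theorem IsSimple.of_bijective (h : H.IsSimple) (f : Hom H H') (hf : Function.Bijective f.toLinearMap) : H'.IsSimple := by
  haveI := h.1
  refine ⟨hf.1.nontrivial, fun S' => ?_⟩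
  have hS : S'.toSubmodule = (S'.comap f).toSubmodule.map f.toLinearMap := by
    rw [SubMixedHodgeStructure.comap_toSubmodule, Submodule.map_comap_eq_of_surjective hf.2]
  rcases h.2 (S'.comap f) with h0 | h1
  · left; rw [hS, h0, Submodule.map_bot]
  · right; rw [hS, h1, Submodule.map_top, LinearMap.range_eq_top.2 hf.2]

/-- `H ≅ H'` ⇒ (`H` simple iff `H'` simple). [cite: CattaniElZeinGriffithsLe2014, Thm. 3.2.18] -/
theorem isSimple_iff_of_bijective (f : Hom H H') (hf : Function.Bijective f.toLinearMap) : H.IsSimple ↔ H'.IsSimple :=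
  ⟨fun h => h.of_bijective f hf, fun h' =>
    h'.of_bijective (f.inverse hf) (LinearEquiv.ofBijective f.toLinearMap hf).symm.bijective⟩

/-- **A mixed Hodge structure on a one-dimensional space is simple.** [cite: CattaniElZeinGriffithsLe2014, p. 270] -/
theorem isSimple_of_finrank_eq_one [FiniteDimensional ℚ V] (hV : Module.finrank ℚ V = 1) (H : MixedHodgeStructure V) :
    H.IsSimple := by
  refine ⟨Module.nontrivial_of_finrank_eq_succ hV, fun S => ?_⟩
  have hle : Module.finrank ℚ S.toSubmodule ≤ 1 := hV ▸ Submodule.finrank_le S.toSubmodule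
  rcases Nat.le_one_iff_eq_zero_or_eq_one.1 hle with h0 | h1
  · exact Or.inl (Submodule.finrank_eq_zero.1 h0)
  · exact Or.inr (Submodule.eq_top_of_finrank_eq (h1.trans hV.symm))

/-- The Tate structures `ℚ(j)` are simple MHS. [cite: CattaniElZeinGriffithsLe2014, Ex. 3.2.23 (1)] -/
theorem isSimple_tate (j : ℤ) : (HodgeStructure.tate j).toMixedHodgeStructure.IsSimple :=
  isSimple_of_finrank_eq_one (Module.finrank_self ℚ) _

/-- A simple MHS is `ℚ`-split (indeed pure: its weight filtration has a single step). [cite: CattaniElZeinGriffithsLe2014, Ch. 12 footnote 2 (p. 527)] -/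
theorem IsSimple.isSplitOverQ (h : H.IsSimple) : H.IsSplitOverQ :=
  h.isSemisimple.isSplitOverQ

/-- The weight filtration of a simple MHS has a single step: each `W_n` is `0` or `V`. [cite: CattaniElZeinGriffithsLe2014, p. 270] -/
theorem IsSimple.W_eq_bot_or_eq_top (h : H.IsSimple) (n : ℤ) : H.W n = ⊥ ∨ H.W n = ⊤ :=
  h.2 (SubMixedHodgeStructure.weight H n)

/-! ### §4 Semisimple = finite sum of simple sub-MHS -/

/-- If `V` is a finite sum of simple sub-MHS then `H` is semisimple ("semisimple := direct sum of simples").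
[cite: CattaniElZeinGriffithsLe2014, p. 270 and Thm. 3.2.18] -/
theorem isSemisimple_of_finset_isSimple [FiniteDimensional ℚ V] (s : Finset (SubMixedHodgeStructure H))
    (hs : ∀ S ∈ s, S.toMixedHodgeStructure.IsSimple) (htop : ⨆ S ∈ s, S.toSubmodule = ⊤) : H.IsSemisimple :=
  isSemisimple_of_biSup_finset_eq_top id s (fun S hS => (hs S hS).isSemisimple) htop

/-- A non-zero MHS on a finite-dimensional space has a simple sub-MHS (one of minimal positive dimension).
[cite: CattaniElZeinGriffithsLe2014, p. 270] -/
theorem exists_subMixedHodgeStructure_isSimple [FiniteDimensional ℚ V] [Nontrivial V] (H : MixedHodgeStructure V) :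
    ∃ S : SubMixedHodgeStructure H, S.toMixedHodgeStructure.IsSimple := by
  classical
  -- dimensions of non-zero sub-MHS
  let P : ℕ → Prop := fun d => ∃ S : SubMixedHodgeStructure H, S.toSubmodule ≠ ⊥ ∧ Module.finrank ℚ S.toSubmodule = d
  have hP : ∃ d, P d := ⟨_, SubMixedHodgeStructure.top H, by
    rw [SubMixedHodgeStructure.top_toSubmodule]; exact top_ne_bot, rfl⟩
  obtain ⟨S, hS0, hSd⟩ := Nat.find_spec hP
  refine ⟨S, ?_, fun R => ?_⟩
  · exact (Submodule.nontrivial_iff_ne_bot).2 hS0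
  · by_cases hR : R.toSubmodule = ⊥
    · exact Or.inl hR
    · right
      -- `S.ofSub R` is a non-zero sub-MHS of `H` of dimension `≤ dim S`, hence `= dim S` by minimality
      have hR0 : (S.ofSub R).toSubmodule ≠ ⊥ := by
        rw [SubMixedHodgeStructure.ofSub_toSubmodule]
        exact fun h0 => hR ((Submodule.map_injective_of_injective S.toSubmodule.injective_subtype)
          (h0.trans (Submodule.map_bot _).symm))
      have hmin := Nat.find_min' hP ⟨S.ofSub R, hR0, rfl⟩
      rw [← hSd, SubMixedHodgeStructure.ofSub_toSubmodule,
        Submodule.finrank_map_subtype_eq] at hmin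
      exact Submodule.eq_top_of_finrank_eq (le_antisymm (Submodule.finrank_le _) hmin)

/-- **A semisimple MHS is a finite sum of simple sub-MHS** (split off a simple sub-MHS and induct on the
dimension of a complement). [cite: CattaniElZeinGriffithsLe2014, p. 270 and Thm. 3.2.18] -/
theorem IsSemisimple.exists_finset_isSimple [FiniteDimensional ℚ V] (h : H.IsSemisimple) :
    ∃ s : Finset (SubMixedHodgeStructure H), (∀ S ∈ s, S.toMixedHodgeStructure.IsSimple) ∧ ⨆ S ∈ s, S.toSubmodule = ⊤ := by
  classical
  -- induction on the dimension, for all spaces at once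
  suffices key : ∀ (n : ℕ) {W : Type u} [AddCommGroup W] [Module ℚ W] [FiniteDimensional ℚ W] (K : MixedHodgeStructure W),
      Module.finrank ℚ W ≤ n → K.IsSemisimple →
        ∃ s : Finset (SubMixedHodgeStructure K), (∀ S ∈ s, S.toMixedHodgeStructure.IsSimple) ∧ ⨆ S ∈ s, S.toSubmodule = ⊤ from
    key _ H le_rfl h
  intro n
  induction n with
  | zero =>
    intro W _ _ _ K hW _
    haveI : Subsingleton W := Module.finrank_zero_iff.1 (Nat.le_zero.1 hW)
    exact ⟨∅, fun S hS => (Finset.notMem_empty S hS).elim,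
      eq_top_iff.2 fun x _ => by rw [Subsingleton.elim x 0]; exact Submodule.zero_mem _⟩
  | succ n ih =>
    intro W _ _ _ K hW hK
    by_cases hV : Subsingleton W
    · exact ⟨∅, fun S hS => (Finset.notMem_empty S hS).elim,
        eq_top_iff.2 fun x _ => by rw [Subsingleton.elim x 0]; exact Submodule.zero_mem _⟩
    · haveI : Nontrivial W := not_subsingleton_iff_nontrivial.1 hV
      obtain ⟨S₀, hS₀⟩ := K.exists_subMixedHodgeStructure_isSimple
      obtain ⟨T, hT⟩ := hK S₀
      -- the complement has smaller dimension
      haveI := hS₀.nontrivial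
      have hS₀pos : 0 < Module.finrank ℚ S₀.toSubmodule := Module.finrank_pos
      have hdim : Module.finrank ℚ S₀.toSubmodule + Module.finrank ℚ T.toSubmodule = Module.finrank ℚ W := by
        rw [← Submodule.finrank_sup_add_finrank_inf_eq, hT.sup_eq_top, hT.inf_eq_bot, finrank_top, finrank_bot, add_zero]
      have hTn : Module.finrank ℚ T.toSubmodule ≤ n := by omega
      obtain ⟨sT, hsT, hsTtop⟩ := ih T.toMixedHodgeStructure hTn (hK.subMixedHodgeStructure T)
      refine ⟨insert S₀ (sT.image T.ofSub), fun S hS => ?_, ?_⟩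
      · rcases Finset.mem_insert.1 hS with rfl | hS
        · exact hS₀
        · obtain ⟨R, hR, rfl⟩ := Finset.mem_image.1 hS
          obtain ⟨f, hf⟩ := T.exists_hom_ofSub_bijective R
          exact (hsT R hR).of_bijective f hf
      · rw [Finset.iSup_insert, Finset.iSup_finset_image]
        simp only [SubMixedHodgeStructure.ofSub_toSubmodule]
        rw [show (⨆ R ∈ sT, Submodule.map T.toSubmodule.subtype R.toSubmodule) =
            (⨆ R ∈ sT, R.toSubmodule).map T.toSubmodule.subtype by simp only [Submodule.map_iSup],
          hsTtop, Submodule.map_top, Submodule.range_subtype, hT.sup_eq_top]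

/-- **`H` is semisimple iff `V` is a finite sum of simple sub-MHS** ("semisimple := direct sum of simples").
[cite: CattaniElZeinGriffithsLe2014, p. 270 and p. 278] -/
theorem isSemisimple_iff_exists_finset_isSimple [FiniteDimensional ℚ V] :
    H.IsSemisimple ↔ ∃ s : Finset (SubMixedHodgeStructure H),
      (∀ S ∈ s, S.toMixedHodgeStructure.IsSimple) ∧ ⨆ S ∈ s, S.toSubmodule = ⊤ :=
  ⟨IsSemisimple.exists_finset_isSimple, fun ⟨s, hs, htop⟩ => isSemisimple_of_finset_isSimple s hs htop⟩

end MixedHodgeStructure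

end Literature.AlgebraicGeometry.Motives
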